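import Mathlib.Analysis.MeanInequalities
import Literature.Analysis.FunctionSpaces.TorusAgmonLatticeSumExplicit
import Literature.Analysis.FunctionSpaces.TorusFourierSynthesis
import Literature.Analysis.FunctionSpaces.TorusFourierModes
import Literature.Analysis.FunctionSpaces.TorusFourierCalculus
import Literature.Analysis.FunctionSpaces.TorusHNegOnePairing
import HarnessLib

/-!
# Agmon's inequality on `T³` with an explicit constant: `‖v‖²_∞ ≤ (2/π²) ‖∇v‖₂ ‖Δv‖₂`

Analysis/FunctionSpaces support file (everything proved; no definitions, no named facts). For a
smooth real vector field `v : T³ → ℝ³` with zero mean on the unit torus `T³ = (ℝ/ℤ)³` we prove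
the three-dimensional **Agmon inequality with an explicit constant**,

  `‖v(x)‖² ≤ (2/π²) · ‖∇v‖₂ · ‖Δv‖₂`   for every `x`

(`Torus.norm_sq_le_two_div_pi_sq_mul_sqrt`), i.e. `‖v‖_∞ ≤ (√2/π) ‖∇v‖₂^{1/2} ‖Δv‖₂^{1/2}`, in the
tree's vocabulary `‖∇v‖₂² = Torus.gradNormSq v = ∫ ∑ᵢ ‖∂ᵢv‖²` and `‖Δv‖₂² = ∫ ‖Torus.laplacian v‖²`.
This is the constant printed (for `T³`, zero mean) by Ayala 2014, App. A (A.3), after Doering 2009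
and Lu–Doering 2008, where it is derived by splitting the Fourier series at a frequency `κ₀` and
replacing the lattice sums `∑_{|k| ≤ κ₀} |k|⁻²`, `∑_{|k| > κ₀} |k|⁻⁴` by the corresponding
integrals; it is the constant that turns `|∫ u·∇u·Δu| ≤ ‖u‖_∞ ‖∇u‖₂ ‖Δu‖₂` and Young's inequality
into the enstrophy-growth estimate `dℰ/dt ≤ 27/(8π⁴ν³) ℰ³` (`FluidPDE/ExtremeGrowthBounds`).

Proof (Constantin–Foias 1988, Ch. 4; Foias–Manley–Rosa–Temam 2001, Ch. II (A.29)): Fourier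
inversion for the smooth field (`Torus.IsSmooth.fourierSynth_mFourierCoeff`) gives
`‖v(x)‖ ≤ ∑_{k ≠ 0} ‖v̂(k)‖` (the zero mode vanishes for zero-mean fields); Cauchy–Schwarz with the
weights `μₖ + μₖ²/ρ`, `μₖ = 4π²|k|²`, gives
`‖v(x)‖² ≤ (‖∇v‖₂² + ‖Δv‖₂²/ρ) · ∑_{k≠0} ρ/(μₖ(μₖ+ρ))` (Parseval for `∂ⱼv` and `Δv`,
`Torus.mFourierCoeff_complexify_partialDeriv`, `Torus.mFourierCoeff_complexify_laplacian`); the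
EXPLICIT lattice-sum bound `∑_{k≠0} ρ/(μₖ(μₖ+ρ)) ≤ ρ^{1/2}/π²` for `ρ ≥ 4π²`
(`Torus.tsum_agmonWeight_le_sqrt_div_pi_sq`, `TorusAgmonLatticeSumExplicit`) and the choice
`ρ = ‖Δv‖₂²/‖∇v‖₂² ≥ 4π²` finish the proof.

* `Torus.norm_sq_le_agmonWeight_explicit` — the bound for a free parameter `ρ ≥ 4π²`;
* `Torus.norm_sq_le_two_div_pi_sq_mul_sqrt` — `‖v x‖² ≤ (2/π²) √(‖∇v‖₂²) √(‖Δv‖₂²)`;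
* `Torus.norm_pow_four_le_agmon_explicit` — the same without square roots,
  `‖v x‖⁴ ≤ (4/π⁴) ‖∇v‖₂² ‖Δv‖₂²`.

## Mathlib / tree search

Mathlib: `Real.inner_le_Lp_mul_Lq_tsum_of_nonneg` (Hölder/Cauchy–Schwarz for `tsum`),
`norm_tsum_le_tsum_norm`, `hasSum_sum`, `le_hasSum`. Tree: `Torus.IsSmooth.fourierSynth_mFourierCoeff`,
`Torus.RapidDecay.hasSum_fourierSynth`, `Torus.norm_mFourier_smul` (`TorusFourierSynthesis`);
`Torus.hasSum_sq_mFourierCoeff_euclidean`, `Torus.mFourierCoeff_complexify_partialDeriv`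
(`TorusFourierCalculus`, `TorusTrigPoly`), `Torus.mFourierCoeff_complexify_laplacian`
(`TorusFourierModes`), `Torus.mFourierCoeff_complexify_zero_of_hasZeroMean` (`TorusHNegOnePairing`),
`Torus.tsum_agmonWeight_le_sqrt_div_pi_sq` (`TorusAgmonLatticeSumExplicit`). Existing sup bounds
on the torus (`TorusSobolevSup`, `TorusSmallnessInterpolation`, `TorusInverseLaplacianSup`,
`TorusAgmonLatticeSum`) carry existential constants only (searched `Agmon`, `norm_sq_le`,
`le_sqrt` under `FunctionSpaces/Torus*`).

## References

* P. Constantin, C. Foias, *Navier–Stokes Equations*, Univ. Chicago Press 1988, Ch. 4.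
  [ConstantinFoias1988]
* C. Foias, O. Manley, R. Rosa, R. Temam, *Navier–Stokes Equations and Turbulence*, CUP 2001,
  Ch. II App. A (A.29). [FoiasManleyRosaTemam2001]
* D. Ayala, *Extreme vortex states and singularity formation in incompressible flows*, PhD thesis,
  McMaster Univ. 2014, App. A (A.1)–(A.3). [Ayala2014Thesis]
* L. Lu, C. R. Doering, *Limits on enstrophy growth for solutions of the three-dimensional
  Navier–Stokes equations*, Indiana Univ. Math. J. 57 (2008) 2693–2727. [LuDoering2008]
-/

noncomputable section

open MeasureTheory Set Filter Topology Real UnitAddTorus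
open scoped ENNReal NNReal

namespace Literature.Analysis.FunctionSpaces

namespace Torus

variable {d : Type*} [Fintype d] [DecidableEq d]

/-! ### Parseval for the gradient and the Laplacian of a smooth real field (real `HasSum` forms) -/

/-- **Parseval for the gradient**: for a smooth real vector field `v` on `T^d`,
`∑_k 4π²|k|² ‖𝓕(complexify ∘ v)(k)‖² = ∫ ∑ⱼ ‖∂ⱼ v‖² = ‖∇v‖₂²` (as a real `HasSum`;
`𝓕(∂ⱼv)(k) = 2πi kⱼ v̂(k)` and Parseval for each `∂ⱼ v`; Grafakos 2014, Prop. 3.2.6 (8) and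
Prop. 3.2.7 (3)). [cite: Grafakos2014, Prop. 3.2.7 (3)] -/
theorem hasSum_freq_mul_norm_sq_mFourierCoeff {v : UnitAddTorus d → EuclideanSpace ℝ d}
    (hv : IsSmooth v) :
    HasSum (fun k : d → ℤ => 4 * π ^ 2 * freqNormSq k *
      ‖mFourierCoeff (EuclideanSpace.complexify ∘ v) k‖ ^ 2) (gradNormSq v) := by
  have hj : ∀ j : d, HasSum (fun k : d → ℤ => 4 * π ^ 2 * ((k j : ℝ)) ^ 2 *
      ‖mFourierCoeff (EuclideanSpace.complexify ∘ v) k‖ ^ 2) (∫ x, ‖partialDeriv j v x‖ ^ 2) := by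
    intro j
    have hcont : Continuous (EuclideanSpace.complexify ∘ partialDeriv j v) :=
      EuclideanSpace.continuous_complexify.comp (hv.partialDeriv j).continuous
    have h := hasSum_sq_mFourierCoeff_euclidean hcont
    have hnorm : ∀ x, ‖(EuclideanSpace.complexify ∘ partialDeriv j v) x‖ = ‖partialDeriv j v x‖ :=
      fun x => EuclideanSpace.norm_complexify _
    simp_rw [hnorm, mFourierCoeff_complexify_partialDeriv hv j, norm_smul, mul_pow] at h
    refine h.congr_fun fun k => ?_
    congr 1
    simp only [norm_mul, Complex.norm_ofNat, Complex.norm_real, Real.norm_eq_abs,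
      Complex.norm_I, mul_one, Complex.norm_intCast, abs_of_pos Real.pi_pos]
    rw [mul_pow, mul_pow, sq_abs]
    ring
  have hsum := hasSum_sum (s := Finset.univ) fun j _ => hj j
  have hrhs : ∑ j, ∫ x, ‖partialDeriv j v x‖ ^ 2 = gradNormSq v := by
    rw [gradNormSq, integral_finsetSum _ (f := fun j x => ‖partialDeriv j v x‖ ^ 2) fun j _ =>
      ((hv.partialDeriv j).continuous.norm.pow 2).integrable_unitAddTorus]
  rw [hrhs] at hsum
  refine hsum.congr_fun fun k => ?_
  rw [freqNormSq, Finset.mul_sum, Finset.sum_mul]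

/-- **Parseval for the Laplacian**: for a smooth real vector field `v` on `T^d`,
`∑_k (4π²|k|²)² ‖𝓕(complexify ∘ v)(k)‖² = ∫ ‖Δv‖²` (as a real `HasSum`; `𝓕(Δv)(k) = -4π²|k|² v̂(k)`,
Grafakos 2014, Prop. 3.2.6 (8) twice, and Parseval, Prop. 3.2.7 (3)). [cite: Grafakos2014, Prop. 3.2.7 (3)] -/
theorem hasSum_freq_sq_mul_norm_sq_mFourierCoeff {v : UnitAddTorus d → EuclideanSpace ℝ d}
    (hv : IsSmooth v) :
    HasSum (fun k : d → ℤ => (4 * π ^ 2 * freqNormSq k) ^ 2 *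
      ‖mFourierCoeff (EuclideanSpace.complexify ∘ v) k‖ ^ 2) (∫ x, ‖laplacian v x‖ ^ 2) := by
  have hcont : Continuous (EuclideanSpace.complexify ∘ laplacian v) :=
    EuclideanSpace.continuous_complexify.comp hv.laplacian.continuous
  have h := hasSum_sq_mFourierCoeff_euclidean hcont
  have hnorm : ∀ x, ‖(EuclideanSpace.complexify ∘ laplacian v) x‖ = ‖laplacian v x‖ :=
    fun x => EuclideanSpace.norm_complexify _
  simp_rw [hnorm, mFourierCoeff_complexify_laplacian hv, norm_neg, norm_smul, mul_pow] at h
  refine h.congr_fun fun k => ?_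
  congr 1
  rw [Complex.norm_real, Real.norm_eq_abs, sq_abs]

/-! ### The sup bound by the coefficients -/

/-- Fourier inversion bounds the sup norm by the `ℓ¹` norm of the coefficients:
`‖v(x)‖ ≤ ∑_k ‖𝓕(complexify ∘ v)(k)‖` for smooth `v` (Fourier inversion for absolutely summable
coefficients, Grafakos 2014, Prop. 3.2.5, and `|e_k(x)| = 1`). [cite: Grafakos2014, Prop. 3.2.5] -/
theorem norm_le_tsum_norm_mFourierCoeff {v : UnitAddTorus d → EuclideanSpace ℝ d}
    (hv : IsSmooth v) (x : UnitAddTorus d) :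
    ‖v x‖ ≤ ∑' k : d → ℤ, ‖mFourierCoeff (EuclideanSpace.complexify ∘ v) k‖ := by
  set w : UnitAddTorus d → EuclideanSpace ℂ d := EuclideanSpace.complexify ∘ v with hw_def
  have hw : IsSmooth w := hv.complexify_comp
  have hc := hw.rapidDecay_mFourierCoeff
  have hsum : HasSum (fun k => mFourier k x • mFourierCoeff w k) (w x) := by
    have := hc.hasSum_fourierSynth x
    rwa [hw.fourierSynth_mFourierCoeff] at this
  have hsn : Summable fun k => ‖mFourier k x • mFourierCoeff w k‖ := by
    simp_rw [norm_mFourier_smul]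
    exact hc.summable_norm
  calc ‖v x‖ = ‖w x‖ := by rw [hw_def, Function.comp_apply, EuclideanSpace.norm_complexify]
    _ = ‖∑' k, mFourier k x • mFourierCoeff w k‖ := by rw [hsum.tsum_eq]
    _ ≤ ∑' k, ‖mFourier k x • mFourierCoeff w k‖ := norm_tsum_le_tsum_norm hsn
    _ = ∑' k, ‖mFourierCoeff w k‖ := tsum_congr fun k => norm_mFourier_smul k x _

/-! ### Agmon's inequality with the explicit constant -/

/-- **Agmon's inequality on `T³`, Cauchy–Schwarz form with a free parameter.** For a smooth
zero-mean real vector field `v` on `T^d`, `card d = 3`, every `ρ ≥ 4π²` and every `x`,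
`‖v(x)‖² ≤ (‖∇v‖₂² + ‖Δv‖₂²/ρ) · ρ^{1/2}/π²`
(`(∑_{k≠0} ‖v̂ₖ‖)² ≤ ∑ (μₖ + μₖ²/ρ)‖v̂ₖ‖² · ∑_{k≠0} ρ/(μₖ(μₖ+ρ))`, `μₖ = 4π²|k|²`, and the explicit
lattice sum `Torus.tsum_agmonWeight_le_sqrt_div_pi_sq`). [cite: ConstantinFoias1988, Ch. 4] -/
theorem norm_sq_le_agmonWeight_explicit (hd : Fintype.card d = 3)
    {v : UnitAddTorus d → EuclideanSpace ℝ d} (hv : IsSmooth v) (hmean : HasZeroMean v)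
    {ρ : ℝ} (hρ : 4 * π ^ 2 ≤ ρ) (x : UnitAddTorus d) :
    ‖v x‖ ^ 2 ≤ (gradNormSq v + (∫ y, ‖laplacian v y‖ ^ 2) / ρ) * (Real.sqrt ρ / π ^ 2) := by
  classical
  haveI : Nonempty d := by
    rw [← Fintype.card_pos_iff, hd]; norm_num
  have hπ : 0 < π := Real.pi_pos
  have hρ0 : 0 < ρ := lt_of_lt_of_le (by positivity) hρ
  set c : (d → ℤ) → EuclideanSpace ℂ d := fun k => mFourierCoeff (EuclideanSpace.complexify ∘ v) k
    with hc_def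
  set μ : (d → ℤ) → ℝ := fun k => 4 * π ^ 2 * freqNormSq k with hμ_def
  have hμ0 : ∀ k, 0 ≤ μ k := fun k => by
    have := freqNormSq_nonneg k; simp only [hμ_def]; positivity
  have hμpos : ∀ {k : d → ℤ}, k ≠ 0 → 0 < μ k := fun hk => by
    have := one_le_freqNormSq_of_ne_zero hk; simp only [hμ_def]; positivity
  have hc0 : c 0 = 0 := mFourierCoeff_complexify_zero_of_hasZeroMean hv.integrable hmean
  -- Parseval sums
  have hA := hasSum_freq_mul_norm_sq_mFourierCoeff hv
  have hB := hasSum_freq_sq_mul_norm_sq_mFourierCoeff hv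
  set A2 : ℝ := gradNormSq v with hA2
  set B2 : ℝ := ∫ y, ‖laplacian v y‖ ^ 2 with hB2
  -- the weights `W k = μ k + μ k ^ 2 / ρ` and the Cauchy–Schwarz factors
  set W : (d → ℤ) → ℝ := fun k => μ k + μ k ^ 2 / ρ with hW_def
  have hW0 : ∀ k, 0 ≤ W k := fun k => by
    have := hμ0 k; simp only [hW_def]; positivity
  have hWpos : ∀ {k : d → ℤ}, k ≠ 0 → 0 < W k := fun hk => by
    have := hμpos hk; simp only [hW_def]; positivity
  set f : (d → ℤ) → ℝ := fun k => Real.sqrt (W k) * ‖c k‖ with hf_def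
  set g : (d → ℤ) → ℝ := fun k => if k = 0 then 0 else (Real.sqrt (W k))⁻¹ with hg_def
  have hf0 : ∀ k, 0 ≤ f k := fun k => by simp only [hf_def]; positivity
  have hg0 : ∀ k, 0 ≤ g k := fun k => by
    simp only [hg_def]; split_ifs
    · exact le_rfl
    · positivity
  -- `f k * g k = ‖c k‖`
  have hfg : ∀ k, f k * g k = ‖c k‖ := by
    intro k
    by_cases hk : k = 0
    · simp [hf_def, hg_def, hk, hc0]
    · have hs : 0 < Real.sqrt (W k) := Real.sqrt_pos.2 (hWpos hk)
      simp only [hf_def, hg_def, if_neg hk]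
      field_simp
  -- `f k ^ 2 = μ‖c‖² + (μ²‖c‖²)/ρ` and its sum
  have hf2 : HasSum (fun k => f k ^ (2 : ℝ)) (A2 + B2 / ρ) := by
    have h := hA.add (hB.div_const ρ)
    refine h.congr_fun fun k => ?_
    simp only [hf_def, Real.rpow_two]
    rw [mul_pow, Real.sq_sqrt (hW0 k), hW_def]
    simp only [hμ_def]
    ring
  -- `g k ^ 2` is the Agmon weight
  have hg2eq : ∀ k, g k ^ (2 : ℝ) = (if k = 0 then (0 : ℝ) else
      ρ / (4 * π ^ 2 * freqNormSq k * (4 * π ^ 2 * freqNormSq k + ρ))) := by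
    intro k
    rw [Real.rpow_two]
    by_cases hk : k = 0
    · simp [hg_def, hk]
    · simp only [hg_def, if_neg hk]
      rw [inv_pow, Real.sq_sqrt (hW0 k)]
      simp only [hW_def, hμ_def]
      have hm : 0 < 4 * π ^ 2 * freqNormSq k := hμpos hk
      have hf : 0 < freqNormSq k := lt_of_lt_of_le one_pos (one_le_freqNormSq_of_ne_zero hk)
      field_simp
      ring
  have hg2s : Summable fun k => g k ^ (2 : ℝ) := by
    simp_rw [hg2eq]
    exact summable_agmonWeight hd.le hρ0
  have hg2le : ∑' k, g k ^ (2 : ℝ) ≤ Real.sqrt ρ / π ^ 2 := by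
    simp_rw [hg2eq]
    exact tsum_agmonWeight_le_sqrt_div_pi_sq hd hρ
  -- Cauchy–Schwarz
  have hCS := Real.inner_le_Lp_mul_Lq_tsum_of_nonneg Real.HolderConjugate.two_two hf0 hg0
    hf2.summable hg2s
  rw [hf2.tsum_eq] at hCS
  have hsup : ‖v x‖ ≤ ∑' k, f k * g k := by
    simp_rw [hfg]
    exact norm_le_tsum_norm_mFourierCoeff hv x
  have hX0 : 0 ≤ A2 + B2 / ρ := by
    have h1 : 0 ≤ A2 := by rw [hA2, gradNormSq]; positivity
    have h2 : 0 ≤ B2 := by rw [hB2]; positivity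
    positivity
  have hY0 : 0 ≤ ∑' k, g k ^ (2 : ℝ) := tsum_nonneg fun k => by rw [Real.rpow_two]; positivity
  have hv0 : 0 ≤ ‖v x‖ := norm_nonneg _
  -- square: `‖v x‖² ≤ X · Y`
  have hsq : ‖v x‖ ^ 2 ≤ (A2 + B2 / ρ) * ∑' k, g k ^ (2 : ℝ) := by
    have h1 : ‖v x‖ ≤ (A2 + B2 / ρ) ^ (1 / (2 : ℝ)) * (∑' k, g k ^ (2 : ℝ)) ^ (1 / (2 : ℝ)) :=
      hsup.trans hCS
    have h2 := pow_le_pow_left₀ hv0 h1 2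
    refine h2.trans (le_of_eq ?_)
    rw [mul_pow, ← Real.sqrt_eq_rpow, ← Real.sqrt_eq_rpow, Real.sq_sqrt hX0, Real.sq_sqrt hY0]
  exact hsq.trans (mul_le_mul_of_nonneg_left hg2le hX0)

/-- **Agmon's inequality on `T³` with the explicit constant `2/π²`.** For a smooth zero-mean real
vector field `v` on `T^d`, `card d = 3`, and every `x`,
`‖v(x)‖² ≤ (2/π²) · (‖∇v‖₂²)^{1/2} · (‖Δv‖₂²)^{1/2}`, i.e.
`‖v‖_∞ ≤ (√2/π) ‖∇v‖₂^{1/2} ‖Δv‖₂^{1/2}` (Ayala 2014, App. A (A.3); the choice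
`ρ = ‖Δv‖₂²/‖∇v‖₂² ≥ 4π²` in `norm_sq_le_agmonWeight_explicit`). [cite: Ayala2014Thesis, App. A (A.3)] -/
theorem norm_sq_le_two_div_pi_sq_mul_sqrt (hd : Fintype.card d = 3)
    {v : UnitAddTorus d → EuclideanSpace ℝ d} (hv : IsSmooth v) (hmean : HasZeroMean v)
    (x : UnitAddTorus d) :
    ‖v x‖ ^ 2 ≤ 2 / π ^ 2 * Real.sqrt (gradNormSq v) * Real.sqrt (∫ y, ‖laplacian v y‖ ^ 2) := by
  classical
  have hπ : 0 < π := Real.pi_pos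
  obtain ⟨A2, hA2⟩ : ∃ A2 : ℝ, A2 = gradNormSq v := ⟨_, rfl⟩
  obtain ⟨B2, hB2⟩ : ∃ B2 : ℝ, B2 = ∫ y, ‖laplacian v y‖ ^ 2 := ⟨_, rfl⟩
  rw [← hA2, ← hB2]
  have hA := hasSum_freq_mul_norm_sq_mFourierCoeff hv
  rw [← hA2] at hA
  have hB := hasSum_freq_sq_mul_norm_sq_mFourierCoeff hv
  rw [← hB2] at hB
  have hA0 : 0 ≤ A2 := by rw [hA2, gradNormSq]; positivity
  have hB0 : 0 ≤ B2 := by rw [hB2]; positivity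
  -- termwise `4π² · (μ‖c‖²) ≤ μ²‖c‖²`, hence `4π² A2 ≤ B2`
  have hAB : 4 * π ^ 2 * A2 ≤ B2 := by
    have h1 := hA.mul_left (4 * π ^ 2)
    refine hasSum_le (fun k => ?_) h1 hB
    by_cases hk : k = 0
    · subst hk; simp
    · have hf := one_le_freqNormSq_of_ne_zero hk
      have hn : 0 ≤ ‖mFourierCoeff (EuclideanSpace.complexify ∘ v) k‖ ^ 2 := sq_nonneg _
      have : 4 * π ^ 2 * (4 * π ^ 2 * freqNormSq k) ≤ (4 * π ^ 2 * freqNormSq k) ^ 2 := by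
        have h4 : 0 < 4 * π ^ 2 := by positivity
        nlinarith
      nlinarith
  rcases eq_or_lt_of_le hA0 with hAz | hApos
  · -- degenerate case `‖∇v‖₂ = 0`: all nonzero modes vanish, so `v x = 0`
    have hzero : ∀ k : d → ℤ, ‖mFourierCoeff (EuclideanSpace.complexify ∘ v) k‖ = 0 := by
      intro k
      by_cases hk : k = 0
      · rw [hk, mFourierCoeff_complexify_zero_of_hasZeroMean hv.integrable hmean, norm_zero]
      · have hle := le_hasSum hA k fun j _ => by
          have := freqNormSq_nonneg j; positivity
        rw [← hAz] at hle
        have hμ : 0 < 4 * π ^ 2 * freqNormSq k := by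
          have := one_le_freqNormSq_of_ne_zero hk; positivity
        have hsq : ‖mFourierCoeff (EuclideanSpace.complexify ∘ v) k‖ ^ 2 ≤ 0 :=
          le_of_mul_le_mul_left (by linarith [hle]) hμ
        exact pow_eq_zero_iff two_ne_zero |>.1 (le_antisymm hsq (sq_nonneg _))
    have hvx : ‖v x‖ ≤ 0 := by
      refine (norm_le_tsum_norm_mFourierCoeff hv x).trans (le_of_eq ?_)
      simp_rw [hzero, tsum_zero]
    have h0 : ‖v x‖ = 0 := le_antisymm hvx (norm_nonneg _)
    have hR : 0 ≤ 2 / π ^ 2 * Real.sqrt A2 * Real.sqrt B2 := by positivity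
    nlinarith [h0, hR]
  · -- `ρ = B2/A2 ≥ 4π²`
    have hBpos : 0 < B2 := lt_of_lt_of_le (by positivity) hAB
    set ρ : ℝ := B2 / A2 with hρ_def
    have hρ : 4 * π ^ 2 ≤ ρ := by
      rw [hρ_def, le_div_iff₀ hApos]; exact hAB
    have h := norm_sq_le_agmonWeight_explicit hd hv hmean hρ x
    rw [← hA2, ← hB2] at h
    refine h.trans (le_of_eq ?_)
    have hAne : A2 ≠ 0 := hApos.ne'
    have e1 : A2 + B2 / ρ = 2 * A2 := by
      rw [hρ_def]; field_simp; ring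
    have e2 : Real.sqrt ρ = Real.sqrt B2 / Real.sqrt A2 := by
      rw [hρ_def, Real.sqrt_div' _ hA0]
    have e3 : A2 = Real.sqrt A2 * Real.sqrt A2 := (Real.mul_self_sqrt hA0).symm
    have hsA : 0 < Real.sqrt A2 := Real.sqrt_pos.2 hApos
    rw [e1, e2]
    nth_rewrite 1 [e3]
    field_simp

/-- **Agmon's inequality on `T³`, explicit constant, without square roots**:
`‖v(x)‖⁴ ≤ (4/π⁴) ‖∇v‖₂² ‖Δv‖₂²` for smooth zero-mean `v` on `T^d`, `card d = 3`. [cite: Ayala2014Thesis, App. A (A.3)] -/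
theorem norm_pow_four_le_agmon_explicit (hd : Fintype.card d = 3)
    {v : UnitAddTorus d → EuclideanSpace ℝ d} (hv : IsSmooth v) (hmean : HasZeroMean v)
    (x : UnitAddTorus d) :
    ‖v x‖ ^ 4 ≤ 4 / π ^ 4 * gradNormSq v * ∫ y, ‖laplacian v y‖ ^ 2 := by
  have h := norm_sq_le_two_div_pi_sq_mul_sqrt hd hv hmean x
  have hA0 : 0 ≤ gradNormSq v := by rw [gradNormSq]; positivity
  have hB0 : 0 ≤ ∫ y, ‖laplacian v y‖ ^ 2 := by positivity
  have hR : 0 ≤ 2 / π ^ 2 * Real.sqrt (gradNormSq v) * Real.sqrt (∫ y, ‖laplacian v y‖ ^ 2) := by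
    positivity
  have h2 := pow_le_pow_left₀ (sq_nonneg _) h 2
  rw [← pow_mul] at h2
  refine h2.trans (le_of_eq ?_)
  rw [mul_pow, mul_pow, Real.sq_sqrt hA0, Real.sq_sqrt hB0]
  ring

end Torus

end Literature.Analysis.FunctionSpaces

end
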